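import Literature.NumberTheory.EllipticCurves.LocalKummerMap
import Literature.NumberTheory.EllipticCurves.KummerMap
import Literature.NumberTheory.GaloisRepresentations.AbsGaloisGroup
import Mathlib.RingTheory.RootsOfUnity.AlgebraicallyClosed
import Mathlib.LinearAlgebra.FiniteDimensional.Lemmas
import Mathlib.LinearAlgebra.Finsupp.LinearCombination
import HarnessLib

/-!
# Tate parametrisations and the `p`-torsion of `E(K̄_v)`: the line `Φ(μ_p)`

`Proofs`-style file (theorems only: no definition, no named fact) in topic
`NumberTheory/EllipticCurves`. Elementary consequences of the SHAPE of a Tate parametrisation —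
an additive homomorphism `Φ : K̄_v^* → E(K̄_v)` (`Additive (K̄_v)ˣ →+ localPoints W K_v`) with
kernel `q^ℤ`, `0 < |q|_v < 1`, equivariant for `Γ_{K_v}` — as provided by the named fact
`Silverman1994_thmV53_tateUniformisation` (`TateUniformisation.lean`; Silverman *ATAEC* V.3.1,
V.5.3); the fact itself is NOT used here (the parametrisation enters as explicit hypotheses), so
nothing in this file is conditional. Consumer: `CongruenceVisibilityMultiplicative.lean` (the
local Kummer conditions of two `p`-congruent curves agree at a place where both have split
multiplicative reduction; cell `b2b-bsdres`, whose HONEST FRAMING applies to that use: delete the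
COMBINATION-shaped residual classes of rank `≤ 1` curves from PUBLISHED theorems only, type the
construction-shaped remainder; not "finishing BSD").

* `zpow_algebraMap_eq_one_imp` — `q^n = 1` in `K̄_v` forces `n = 0` (`0 < |q|_v < 1`);
* `zsmul_map_ofMul_eq_zero_of_pow_eq_one`, `map_ofMul_ne_zero_of_pow_eq_one`,
  `map_ofMul_mul_ne_zero_of_pow_eq` — `Φ(μ_p) ⊆ E[p]`, `Φ(ζ) ≠ 0` for `ζ ∈ μ_p ∖ {1}`, and
  `Φ(w₀ζ) ≠ 0` for `w₀^p = q`, `ζ ∈ μ_p` (the point `Φ(w₀)` is off the line `Φ(μ_p)`);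
* `sq_le_card_ker_nsmul_of_forall_smul_eq` — if `Γ_{K_v}` fixes every point of `E(K̄_v)[p]` then
  `#E(K_v)[p] ≥ p²` (Galois descent to Mathlib's `K_v`-rational points, `#E[p] = p²`);
* `exists_eq_nsmul_or_forall_smul_eq` — **the dichotomy**: for a primitive `p`-th root of unity
  `ζ₀` and a `p`-torsion point `L₂` on which `Γ_{K_v}` acts through the mod-`p` cyclotomic
  character (as it does on `L₁ = Φ(ζ₀)`), either `L₂ ∈ ℤ L₁`, or `Γ_{K_v}` fixes all of `E(K̄_v)[p]`
  (linear algebra in the `𝔽_p`-plane `E[p]`: if `L₁, L₂` is a basis, `Γ_{K_v}` acts by scalars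
  `c(σ)`, and `σΦ(w₀) − Φ(w₀) = Φ(σw₀/w₀) ∈ ℤ L₁` with `Φ(w₀) ∉ ℤ L₁` forces `c(σ) = 1`).

References: [SilvermanATAEC1994] J. H. Silverman, *Advanced Topics in the Arithmetic of Elliptic
Curves*, GTM 151, Ch. V §§3–5; [SilvermanAEC2009] J. H. Silverman, *The Arithmetic of Elliptic
Curves*, 2nd ed., III.6.4 (`#E[p] = p²`), VIII.§1 (Galois descent).
-/

noncomputable section

open scoped Classical

open NumberField IsDedekindDomain Field

namespace WeierstrassCurve

open Literature.NumberTheory.EllipticCurves Literature.NumberTheory.GaloisRepresentations Field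
open NumberField IsDedekindDomain

section Local

variable {K : Type} [Field K] [NumberField K] (W : WeierstrassCurve K) [W.IsElliptic]
  {p : ℕ} [hp : Fact p.Prime] (v : HeightOneSpectrum (𝓞 K))



/-- A non-zero element of `K_v` of absolute value `< 1` has no non-trivial power equal to `1` in
`K̄_v`. [folklore] -/
theorem zpow_algebraMap_eq_one_imp {q : (v.adicCompletion K)} (hq0 : q ≠ 0) (hq1 : Valued.v q < 1)
      {n : ℤ}
    (h : algebraMap (v.adicCompletion K) (AlgebraicClosure (v.adicCompletion K)) q ^ n = 1) : n
          = 0 := by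
  have h' : q ^ n = 1 := by
    apply (algebraMap (v.adicCompletion K) (AlgebraicClosure (v.adicCompletion K))).injective
    rw [map_zpow₀, h, map_one]
  have hv : (Valued.v q) ^ n = (Valued.v q) ^ (0 : ℤ) := by
    rw [← map_zpow₀, h', map_one, zpow_zero]
  have h0 : 0 < Valued.v q := zero_lt_iff.mpr ((Valuation.ne_zero_iff _).mpr hq0)
  exact (zpow_right_strictAnti₀ h0 hq1).injective hv

omit [W.IsElliptic] hp in
/-- Roots of unity are mapped by a Tate parametrisation to `p`-torsion points: if `ζ^p = 1` then
`p · Φ(ζ) = 0`. [folklore] -/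
theorem zsmul_map_ofMul_eq_zero_of_pow_eq_one
    (Φ : Additive (AlgebraicClosure (v.adicCompletion K))ˣ →+ localPoints W (v.adicCompletion K))
          {ζ : (AlgebraicClosure (v.adicCompletion K))ˣ} (hζ : ζ ^ p = 1) :
    (p : ℤ) • Φ (Additive.ofMul ζ) = 0 := by
  rw [← map_zsmul, ← ofMul_zpow, zpow_natCast, hζ, ofMul_one, map_zero]

omit [W.IsElliptic] in
/-- A Tate parametrisation with kernel `q^ℤ`, `|q|_v < 1`, does not kill a non-trivial root of
unity. [folklore] -/
theorem map_ofMul_ne_zero_of_pow_eq_one {q : (v.adicCompletion K)} (hq0 : q ≠ 0)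
      (hq1 : Valued.v q < 1)
    (Φ : Additive (AlgebraicClosure (v.adicCompletion K))ˣ →+ localPoints W (v.adicCompletion K))
    (hker : ∀ u : (AlgebraicClosure (v.adicCompletion K))ˣ, Φ (Additive.ofMul u) = 0 ↔ ∃ n : ℤ,
          (u : (AlgebraicClosure (v.adicCompletion K)))
          = algebraMap (v.adicCompletion K) (AlgebraicClosure (v.adicCompletion K)) q ^ n)
    {ζ : (AlgebraicClosure (v.adicCompletion K))ˣ} (hζ : ζ ^ p
          = 1) (hζ1 : ζ ≠ 1) : Φ (Additive.ofMul ζ) ≠ 0 := by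
  intro h0
  obtain ⟨n, hn⟩ := (hker ζ).mp h0
  have h1 : algebraMap (v.adicCompletion K) (AlgebraicClosure (v.adicCompletion K)) q ^ (n * p)
        = 1 := by
    rw [zpow_mul, ← hn, zpow_natCast, ← Units.val_pow_eq_pow_val, hζ, Units.val_one]
  have h2 : n * p = 0 := zpow_algebraMap_eq_one_imp v hq0 hq1 h1
  have h3 : n = 0 := by
    rcases mul_eq_zero.mp h2 with h | h
    · exact h
    · exact absurd h (by exact_mod_cast hp.out.ne_zero)
  rw [h3, zpow_zero] at hn
  exact hζ1 (Units.ext hn)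

omit [W.IsElliptic] in
/-- A Tate parametrisation with kernel `q^ℤ`, `|q|_v < 1`, does not kill `w₀ ζ` for a `p`-th root
`w₀` of `q` and a `p`-th root of unity `ζ` (`p ≥ 2`). [folklore] -/
theorem map_ofMul_mul_ne_zero_of_pow_eq {q : (v.adicCompletion K)} (hq0 : q ≠ 0)
      (hq1 : Valued.v q < 1)
    (Φ : Additive (AlgebraicClosure (v.adicCompletion K))ˣ →+ localPoints W (v.adicCompletion K))
    (hker : ∀ u : (AlgebraicClosure (v.adicCompletion K))ˣ, Φ (Additive.ofMul u) = 0 ↔ ∃ n : ℤ,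
          (u : (AlgebraicClosure (v.adicCompletion K)))
          = algebraMap (v.adicCompletion K) (AlgebraicClosure (v.adicCompletion K)) q ^ n)
    {w₀ ζ : (AlgebraicClosure (v.adicCompletion K))ˣ} (hw₀ : (w₀ : (AlgebraicClosure
          (v.adicCompletion K))) ^ p = algebraMap (v.adicCompletion K) (AlgebraicClosure
          (v.adicCompletion K)) q) (hζ : ζ ^ p = 1) :
    Φ (Additive.ofMul (w₀ * ζ)) ≠ 0 := by
  intro h0
  obtain ⟨n, hn⟩ := (hker _).mp h0
  have hq' : algebraMap (v.adicCompletion K) (AlgebraicClosure (v.adicCompletion K)) q ≠ 0 := by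
    rw [Ne, map_eq_zero_iff _ (algebraMap (v.adicCompletion K) (AlgebraicClosure
          (v.adicCompletion K))).injective]; exact hq0
  have h1 : algebraMap (v.adicCompletion K) (AlgebraicClosure (v.adicCompletion K)) q ^
        (n * p - 1) = 1 := by
    have e : ((w₀ * ζ : (AlgebraicClosure (v.adicCompletion K))ˣ) : (AlgebraicClosure
          (v.adicCompletion K))) ^ p = algebraMap (v.adicCompletion K) (AlgebraicClosure
          (v.adicCompletion K)) q := by
      rw [Units.val_mul, mul_pow, hw₀, ← Units.val_pow_eq_pow_val, hζ, Units.val_one, mul_one]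
    rw [hn, ← zpow_natCast, ← zpow_mul] at e
    rw [zpow_sub_one₀ hq', e, mul_inv_cancel₀ hq']
  have h2 : n * p - 1 = 0 := zpow_algebraMap_eq_one_imp v hq0 hq1 h1
  have h3 : (p : ℤ) ∣ 1 := ⟨n, by linarith⟩
  exact hp.out.ne_one (by exact_mod_cast Int.eq_one_of_dvd_one (by positivity) h3)

/-- **If every `p`-torsion point of `E(K̄_v)` is fixed by `Γ_{K_v}` then `#E(K_v)[p] ≥ p²`**
(Galois descent onto Mathlib's `K_v`-rational points; `#E(K̄_v)[p] = p²`, Silverman *AEC*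
III.6.4). [folklore] -/
theorem sq_le_card_ker_nsmul_of_forall_smul_eq
    (hfix : ∀ X : localPoints W (v.adicCompletion K), (p : ℤ) • X = 0
          → ∀ σ : (absoluteGaloisGroup (v.adicCompletion K)), σ • X = X) :
    p ^ 2 ≤ Nat.card (nsmulAddMonoidHom p : (W.baseChange (v.adicCompletion K)).toAffine.Point
          →+ _).ker := by
  haveI : CharZero (v.adicCompletion K) := charZero_adicCompletion v
  have hn : (p : ℤ) ≠ 0 := by exact_mod_cast hp.out.ne_zero
  haveI := W.finite_ker_nsmul_adicCompletion v hp.out.ne_zero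
  -- every `Γ`-fixed local point comes from a `K_v`-rational point
  have hdesc : ∀ X : AddSubgroup.torsionBy (localPoints W (v.adicCompletion K)) (p : ℤ),
      ∃ P : (nsmulAddMonoidHom p : (W.baseChange (v.adicCompletion K)).toAffine.Point →+ _).ker,
        W.baseChangeGeomPointsEquiv (v.adicCompletion K) (toGeomPoints (W.baseChange
              (v.adicCompletion K)) (P : _)) = X := by
    intro X
    have hX : (p : ℤ) • (X : localPoints W (v.adicCompletion K)) = 0
          := (Submodule.mem_torsionBy_iff _ _).mp X.2
    have hfixX : (W.baseChangeGeomPointsEquiv (v.adicCompletion K)).symm (X : localPoints W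
          (v.adicCompletion K)) ∈
        MulAction.fixedPoints (absoluteGaloisGroup (v.adicCompletion K)) (geomPoints (W.baseChange
              (v.adicCompletion K))) := fun σ ↦ by
      rw [← baseChangeGeomPointsEquiv_symm_smul, hfix _ hX σ]
    obtain ⟨P, hP⟩ := (mem_range_toGeomPoints_iff (W.baseChange (v.adicCompletion K)) _).mpr hfixX
    have hPker : P ∈ (nsmulAddMonoidHom p : (W.baseChange (v.adicCompletion K)).toAffine.Point
          →+ _).ker := by
      rw [AddMonoidHom.mem_ker, nsmulAddMonoidHom_apply]
      apply toGeomPoints_injective (W.baseChange (v.adicCompletion K))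
      apply (W.baseChangeGeomPointsEquiv (v.adicCompletion K)).injective
      rw [map_nsmul, map_nsmul, hP, AddEquiv.apply_symm_apply, map_zero, map_zero,
        ← natCast_zsmul, hX]
    exact ⟨⟨P, hPker⟩, by rw [hP, AddEquiv.apply_symm_apply]⟩
  choose f hf using hdesc
  have hfinj : Function.Injective f := by
    intro X Y h
    apply Subtype.ext
    rw [← hf X, ← hf Y, h]
  calc p ^ 2 = Nat.card (AddSubgroup.torsionBy (localPoints W (v.adicCompletion K)) (p : ℤ)) := by
        rw [W.natCard_torsionBy_localPoints (E := (v.adicCompletion K)) (p : ℤ) hn,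
              Int.natAbs_natCast]
    _ ≤ _ := Nat.card_le_card_of_injective f hfinj


/-- **The two lines `Φ(μ_p)` and `G(μ_p)` of `E[p]` coincide unless all of `E[p]` is
`K_v`-rational.** Let `Φ` be a Tate parametrisation of `E(K̄_v)` with kernel `q^ℤ` (`|q|_v < 1`),
`ζ₀` a primitive `p`-th root of unity in `K̄_v`, `L₁ = Φ(ζ₀)`, and `L₂ ∈ E(K̄_v)[p]` a
point on which every `σ ∈ Γ_{K_v}` acts through the mod-`p` cyclotomic character
(`σ ζ₀ = ζ₀^c ⇒ σ L₂ = c L₂`, as it does on `L₁`). Then either `L₂ ∈ ℤ L₁`, or every `p`-torsion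
point of `E(K̄_v)` is fixed by `Γ_{K_v}`. (If `L₂ ∉ ℤ L₁` then `L₁, L₂` is a basis of the
`𝔽_p`-plane `E[p]` on which `Γ_{K_v}` acts by the scalars `c(σ)`; but for a `p`-th root `w₀` of `q`
the point `X₀ = Φ(w₀) ∉ ℤ L₁` satisfies `σ X₀ − X₀ = Φ(σw₀/w₀) ∈ ℤ L₁`, forcing `c(σ) ≡ 1`.)
[folklore] -/
theorem exists_eq_nsmul_or_forall_smul_eq {q : (v.adicCompletion K)} (hq0 : q ≠ 0)
      (hq1 : Valued.v q < 1)
    (Φ : Additive (AlgebraicClosure (v.adicCompletion K))ˣ →+ localPoints W (v.adicCompletion K))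
    (hker : ∀ u : (AlgebraicClosure (v.adicCompletion K))ˣ, Φ (Additive.ofMul u) = 0 ↔ ∃ n : ℤ,
          (u : (AlgebraicClosure (v.adicCompletion K)))
          = algebraMap (v.adicCompletion K) (AlgebraicClosure (v.adicCompletion K)) q ^ n)
    (hequiv : ∀ (σ : (absoluteGaloisGroup (v.adicCompletion K))) (u : (AlgebraicClosure
          (v.adicCompletion K))ˣ),
      σ • Φ (Additive.ofMul u)
            = Φ (Additive.ofMul (Units.map (absoluteGaloisGroup.toAlgEquiv _ σ : AlgebraicClosure
                  (v.adicCompletion K) →* _) u)))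
    {Z : (AlgebraicClosure (v.adicCompletion K))ˣ} (hZ : IsPrimitiveRoot (Z : (AlgebraicClosure
          (v.adicCompletion K))) p)
    {L₂ : localPoints W (v.adicCompletion K)} (hL₂p : (p : ℤ) • L₂ = 0)
    (hL₂σ : ∀ (σ : (absoluteGaloisGroup (v.adicCompletion K))) (c : ℕ),
          Units.map (absoluteGaloisGroup.toAlgEquiv _ σ : AlgebraicClosure (v.adicCompletion K)
                →* _) Z = Z ^ c → σ • L₂ = c • L₂) :
    (∃ a : ℕ, L₂ = a • Φ (Additive.ofMul Z)) ∨
      ∀ X : localPoints W (v.adicCompletion K), (p : ℤ) • X = 0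
            → ∀ σ : (absoluteGaloisGroup (v.adicCompletion K)), σ • X = X := by
  classical
  by_cases hA : ∃ a : ℕ, L₂ = a • Φ (Additive.ofMul Z)
  · exact Or.inl hA
  right
  have hA' : ∀ a : ℕ, L₂ ≠ a • Φ (Additive.ofMul Z) := fun a h ↦ hA ⟨a, h⟩
  have hpp : p.Prime := hp.out
  haveI : NeZero p := ⟨hpp.ne_zero⟩
  haveI : CharZero (v.adicCompletion K) := charZero_adicCompletion v
  have hn : (p : ℤ) ≠ 0 := by exact_mod_cast hpp.ne_zero
  have hq' : algebraMap (v.adicCompletion K) (AlgebraicClosure (v.adicCompletion K)) q ≠ 0 := by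
    rw [Ne, map_eq_zero_iff _ (algebraMap (v.adicCompletion K) (AlgebraicClosure
          (v.adicCompletion K))).injective]; exact hq0
  -- the line `L₁ = Φ(ζ₀)`
  set L₁ : localPoints W (v.adicCompletion K) := Φ (Additive.ofMul Z) with hL₁
  have hZp : Z ^ p = 1 := Units.ext (by rw [Units.val_pow_eq_pow_val, hZ.pow_eq_one, Units.val_one])
  have hL₁p : (p : ℤ) • L₁ = 0 := W.zsmul_map_ofMul_eq_zero_of_pow_eq_one v Φ hZp
  have hL₁0 : L₁ ≠ 0 :=
    W.map_ofMul_ne_zero_of_pow_eq_one v hq0 hq1 Φ hker hZp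
      (fun h ↦ hZ.ne_one hpp.one_lt (by rw [h, Units.val_one]))
  -- `Γ_{K_v}` acts on `ζ₀`, `L₁`, `L₂` through the cyclotomic character
  have hcyc : ∀ σ : (absoluteGaloisGroup (v.adicCompletion K)), ∃ c : ℕ,
        Units.map (absoluteGaloisGroup.toAlgEquiv _ σ : AlgebraicClosure (v.adicCompletion K)
              →* _) Z = Z ^ c := by
    intro σ
    have h1 : ((Units.map (absoluteGaloisGroup.toAlgEquiv _ σ : AlgebraicClosure
          (v.adicCompletion K) →* _) Z : (AlgebraicClosure (v.adicCompletion K))ˣ) :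
          (AlgebraicClosure (v.adicCompletion K))) ^ p = 1 := by
      rw [Units.coe_map, MonoidHom.coe_coe, ← map_pow, hZ.pow_eq_one, map_one]
    obtain ⟨c, -, hc⟩ := hZ.eq_pow_of_pow_eq_one h1
    exact ⟨c, Units.ext (by rw [← hc, Units.val_pow_eq_pow_val])⟩
  have hL₁σ : ∀ (σ : (absoluteGaloisGroup (v.adicCompletion K))) (c : ℕ),
        Units.map (absoluteGaloisGroup.toAlgEquiv _ σ : AlgebraicClosure (v.adicCompletion K)
              →* _) Z = Z ^ c → σ • L₁ = c • L₁ := by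
    intro σ c hc
    rw [hL₁, hequiv, hc, ofMul_pow, map_nsmul]
  -- the `𝔽_p`-plane `E[p]`
  set Tor := AddSubgroup.torsionBy (localPoints W (v.adicCompletion K)) (p : ℤ) with hTor
  letI : Module (ZMod p) Tor := AddSubgroup.torsionBy.zmodModule
  have hcardTor : Nat.card Tor = p ^ 2 := by
    rw [hTor, W.natCard_torsionBy_localPoints (E := (v.adicCompletion K)) (p : ℤ) hn,
          Int.natAbs_natCast]
  haveI : Finite Tor
        := Nat.finite_of_card_ne_zero (by rw [hcardTor]; exact pow_ne_zero 2 hpp.ne_zero)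
  haveI : Module.Finite (ZMod p) Tor := Module.Finite.of_finite
  have hrank : Module.finrank (ZMod p) Tor = 2 := by
    have h := Module.natCard_eq_pow_finrank (K := ZMod p) (V := Tor)
    rw [hcardTor, Nat.card_zmod] at h
    exact (Nat.pow_right_injective hpp.two_le h).symm
  have hmem : ∀ {X : localPoints W (v.adicCompletion K)}, (p : ℤ) • X = 0 → X ∈ Tor := fun hX ↦
    (Submodule.mem_torsionBy_iff _ _).mpr hX
  set L₁t : Tor := ⟨L₁, hmem hL₁p⟩ with hL₁t
  set L₂t : Tor := ⟨L₂, hmem hL₂p⟩ with hL₂t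
  -- `ZMod p`-scalars act through representatives
  have hsmul : ∀ (a : ZMod p) (T : Tor), ((a • T : Tor) : localPoints W (v.adicCompletion K))
        = a.val • (T : _) := by
    intro a T
    conv_lhs => rw [← ZMod.natCast_zmod_val a, Nat.cast_smul_eq_nsmul]
    rw [AddSubgroupClass.coe_nsmul]
  have hli : LinearIndependent (ZMod p) ![L₁t, L₂t] := by
    rw [LinearIndependent.pair_iff' (fun h ↦ hL₁0 (congrArg Subtype.val h))]
    intro a ha
    apply hA' a.val
    have h := congrArg Subtype.val ha
    rw [hsmul] at h
    exact h.symm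
  have hspan : Submodule.span (ZMod p) (Set.range ![L₁t, L₂t]) = ⊤ :=
    hli.span_eq_top_of_card_eq_finrank (by rw [hrank, Fintype.card_fin])
  have hdecomp : ∀ X : Tor, ∃ m n : ZMod p, m • L₁t + n • L₂t = X := by
    intro X
    have hX : X ∈ Submodule.span (ZMod p) (Set.range ![L₁t, L₂t]) := by
      rw [hspan]; exact Submodule.mem_top
    obtain ⟨c, hc⟩ := (Submodule.mem_span_range_iff_exists_fun (ZMod p)).mp hX
    refine ⟨c 0, c 1, ?_⟩
    rw [Fin.sum_univ_two] at hc
    simpa using hc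
  -- hence `Γ_{K_v}` acts on `E[p]` by the scalars `c(σ)`
  have hscalar : ∀ (σ : (absoluteGaloisGroup (v.adicCompletion K))) (c : ℕ),
        Units.map (absoluteGaloisGroup.toAlgEquiv _ σ : AlgebraicClosure (v.adicCompletion K)
              →* _) Z = Z ^ c →
      ∀ X : Tor, σ • (X : localPoints W (v.adicCompletion K))
            = c • (X : localPoints W (v.adicCompletion K)) := by
    intro σ c hc X
    obtain ⟨m, n, hX⟩ := hdecomp X
    have hX' : (X : localPoints W (v.adicCompletion K)) = m.val • L₁ + n.val • L₂ := by
      rw [← hX, AddSubgroup.coe_add, hsmul, hsmul]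
    have hσnsmul : ∀ (k : ℕ) (Y : localPoints W (v.adicCompletion K)), σ • (k • Y) = k • (σ • Y) :=
      fun k Y ↦ map_nsmul (DistribSMul.toAddMonoidHom (localPoints W (v.adicCompletion K)) σ) k Y
    rw [hX', smul_add, hσnsmul, hσnsmul, hL₁σ σ c hc, hL₂σ σ c hc]
    simp only [smul_add, smul_smul, mul_comm]
  -- a `p`-th root `w₀` of `q` and the point `X₀ = Φ(w₀)`
  obtain ⟨z, hz⟩ := IsAlgClosed.exists_pow_nat_eq (algebraMap (v.adicCompletion K)
        (AlgebraicClosure (v.adicCompletion K)) q) hpp.pos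
  have hz0 : z ≠ 0 := by
    rintro rfl
    rw [zero_pow hpp.ne_zero] at hz
    exact hq' hz.symm
  set w₀ : (AlgebraicClosure (v.adicCompletion K))ˣ := Units.mk0 z hz0 with hw₀
  have hw₀p : (w₀ : (AlgebraicClosure (v.adicCompletion K))) ^ p
        = algebraMap (v.adicCompletion K) (AlgebraicClosure (v.adicCompletion K)) q := by rw [hw₀,
        Units.val_mk0, hz]
  set X₀ : localPoints W (v.adicCompletion K) := Φ (Additive.ofMul w₀) with hX₀
  have hX₀p : (p : ℤ) • X₀ = 0 := by
    rw [hX₀, ← map_zsmul, ← ofMul_zpow, zpow_natCast, hker]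
    exact ⟨1, by rw [zpow_one, Units.val_pow_eq_pow_val, hw₀p]⟩
  set X₀t : Tor := ⟨X₀, hmem hX₀p⟩ with hX₀t
  obtain ⟨m₀, n₀, hX₀dec⟩ := hdecomp X₀t
  have hn₀ : n₀ ≠ 0 := by
    intro hn0
    rw [hn0, zero_smul, add_zero] at hX₀dec
    have h1 : X₀ = m₀.val • L₁ := by
      have := congrArg Subtype.val hX₀dec
      rw [hsmul] at this
      exact this.symm
    -- `Φ(w₀ · ζ₀^{-m₀}) = 0`: impossible
    apply W.map_ofMul_mul_ne_zero_of_pow_eq v hq0 hq1 Φ hker hw₀p (ζ := (Z ^ m₀.val)⁻¹)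
      (by rw [inv_pow, ← pow_mul, mul_comm, pow_mul, hZp, one_pow, inv_one])
    rw [ofMul_mul, map_add, ofMul_inv, map_neg, ofMul_pow, map_nsmul, ← hL₁, ← h1, hX₀,
      add_neg_cancel]
  -- every `σ` acts trivially on `ζ₀`, i.e. `c(σ) ≡ 1 (mod p)`
  have hone : ∀ (σ : (absoluteGaloisGroup (v.adicCompletion K))) (c : ℕ),
        Units.map (absoluteGaloisGroup.toAlgEquiv _ σ : AlgebraicClosure (v.adicCompletion K)
              →* _) Z = Z ^ c → (c : ZMod p) = 1 := by
    intro σ c hc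
    -- `σ w₀ = ζ w₀` with `ζ^p = 1`, `ζ = ζ₀^k`
    set η : (AlgebraicClosure (v.adicCompletion K))ˣ
          := Units.map (absoluteGaloisGroup.toAlgEquiv _ σ : AlgebraicClosure
                (v.adicCompletion K) →* _) w₀ / w₀ with hη
    have hηp : η ^ p = 1 := by
      apply Units.ext
      rw [Units.val_pow_eq_pow_val, hη, Units.val_div_eq_div_val, div_pow, Units.coe_map,
        MonoidHom.coe_coe, ← map_pow, hw₀p, AlgEquiv.commutes, div_self hq', Units.val_one]
    obtain ⟨k, -, hk⟩ := hZ.eq_pow_of_pow_eq_one (ξ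
          := (η : (AlgebraicClosure (v.adicCompletion K))))
      (by rw [← Units.val_pow_eq_pow_val, hηp, Units.val_one])
    have hηk : η = Z ^ k := Units.ext (by rw [← hk, Units.val_pow_eq_pow_val])
    have hσw₀ : Units.map (absoluteGaloisGroup.toAlgEquiv _ σ : AlgebraicClosure
          (v.adicCompletion K) →* _) w₀ = Z ^ k * w₀ := by
      rw [← hηk, hη, div_mul_cancel]
    have hσX₀ : σ • X₀ = k • L₁ + X₀ := by
      rw [hX₀, hequiv, hσw₀, ofMul_mul, map_add, ofMul_pow, map_nsmul]
    have hσX₀' : σ • X₀ = c • X₀ := hscalar σ c hc X₀t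
    -- compare the two expressions in the basis `L₁, L₂`
    have hpX₀ : p • X₀ = 0 := by rw [← natCast_zsmul]; exact hX₀p
    have hpL₁ : p • L₁ = 0 := by rw [← natCast_zsmul]; exact hL₁p
    have key : ((c : ZMod p) - 1) • X₀t = (k : ZMod p) • L₁t := by
      apply Subtype.ext
      rw [sub_smul, one_smul, AddSubgroupClass.coe_sub, hsmul, hsmul, ZMod.val_natCast,
        ZMod.val_natCast]
      change (c % p) • X₀ - X₀ = (k % p) • L₁
      have e1 : c • X₀ = (c % p) • X₀ := by
        conv_lhs => rw [← Nat.mod_add_div c p]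
        rw [add_nsmul, mul_nsmul, hpX₀, nsmul_zero, add_zero]
      have e2 : k • L₁ = (k % p) • L₁ := by
        conv_lhs => rw [← Nat.mod_add_div k p]
        rw [add_nsmul, mul_nsmul, hpL₁, nsmul_zero, add_zero]
      rw [← e1, ← e2, ← hσX₀', hσX₀, add_sub_cancel_right]
    rw [← hX₀dec, smul_add, smul_smul, smul_smul] at key
    have key' : (((c : ZMod p) - 1) * m₀ - k) • L₁t + (((c : ZMod p) - 1) * n₀) • L₂t = 0 := by
      rw [sub_smul, sub_add_eq_add_sub, key, sub_self]
    obtain ⟨-, h2⟩ := LinearIndependent.pair_iff.mp hli _ _ key'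
    rcases mul_eq_zero.mp h2 with h | h
    · exact sub_eq_zero.mp h
    · exact absurd h hn₀
  -- conclusion
  intro X hX σ
  obtain ⟨c, hc⟩ := hcyc σ
  have h1 : (c : ZMod p) = 1 := hone σ c hc
  have h2 : σ • X = c • X := hscalar σ c hc ⟨X, hmem hX⟩
  rw [h2]
  have hc1 : c % p = 1 := by
    have := (ZMod.natCast_eq_natCast_iff' c 1 p).mp (by rw [h1, Nat.cast_one])
    rw [this, Nat.mod_eq_of_lt hpp.one_lt]
  have hpX : p • X = 0 := by rw [← natCast_zsmul]; exact hX
  conv_lhs => rw [← Nat.mod_add_div c p, hc1]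
  rw [add_nsmul, one_nsmul, mul_nsmul, hpX, nsmul_zero, add_zero]


end Local

end WeierstrassCurve

end
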